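import Mathlib
import Summits.Ventures.PercRepro2.Defs
import Summits.Ventures.PercRepro2.Independence
import Summits.Ventures.PercRepro2.Harris
import Summits.Ventures.PercRepro2.Graph
import Summits.Ventures.PercRepro2.Events
import Summits.Ventures.PercRepro2.BHKEvents
import Summits.Ventures.PercRepro2.RProduct
import Summits.Ventures.PercRepro2.RestrictClosure
import Summits.Ventures.PercRepro2.RootPairSepDefs
import Summits.Ventures.PercRepro2.RootPairSep

/-!
# Root-pair separation: the three split placements of the cleared L-half of the weighted (PM)
(blind cell PercRepro2, mine-2 g21; proofs/MINE2-CUTU.md §10 Theorem 7 (i)–(iii); on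
`RootPairSep.lean`'s conditional independence `prob_side_mul`).  For the cleared L-half (the
expression of `CutMixedPM.halfL_mixed_nonneg`; `Q = {a₁ ↮ a₂}`, `L_b = {a₁ ↔ b}`, `H_v = {a₂ ↔ v}`,
`oU = L_o ∪ H_o`): `b` alone on its side ⇒ `0` (`halfL_eq_zero_of_b_alone`); `o` alone ⇒ `0`
(`halfL_eq_zero_of_o_alone`); `u` alone ⇒
`P(H_u Q)·[P(Q)P(L_b L_o Q) − P(L_b Q)P(L_o Q)] + (P(H_u Q) − P(Q))·[P(Q)P(L_b H_o Q) − P(L_b Q)P(H_o Q)] ≥ 0`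
by BHK 1.3 (`bhk_same_cluster_events`) and BHK 1.4 (`bhk_cross_cluster`) (`halfL_nonneg_of_u_alone`).
The fourth placement (all three marks on one side) is the statement on that side alone; on a cycle
it is the path case of `CutSamePM` / `CutMixedPM`.  Typed version: not claimed.
-/

namespace Summit.Ventures.PercRepro2

namespace RootPairSep

open SepPair

section Main

variable {V : Type*} {E : Type*} [Fintype V] [DecidableEq V] [Fintype E] [DecidableEq E]
  {R : Type*} [CommRing R] [LinearOrder R] [IsStrictOrderedRing R]

omit [Fintype V] [DecidableEq V] in
/-- **Theorem 7 (i).**  If `b` lies on one side of the root pair and `o`, `u` on the other,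
the cleared L-half of the weighted (PM) vanishes. -/
theorem halfL_eq_zero_of_b_alone (p : E → R) {ends : E → Sym2 V} {a₁ a₂ : V}
    {V₁ V₂ : Set V} (hs : IsRootPairSep ends a₁ a₂ V₁ V₂) {o u b : V}
    (ho : o ∈ V₁) (hu : u ∈ V₁) (hb : b ∈ V₂) :
    prob p (connEvent ends a₁ a₂)ᶜ *
          (prob p (connEvent ends a₁ a₂)ᶜ *
              prob p (connEvent ends a₁ b ∩ connEvent ends a₂ u ∩
                (connEvent ends a₁ o ∪ connEvent ends a₂ o) ∩ (connEvent ends a₁ a₂)ᶜ) -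
            prob p (connEvent ends a₁ b ∩ (connEvent ends a₁ a₂)ᶜ) *
              prob p (connEvent ends a₂ u ∩ (connEvent ends a₁ o ∪ connEvent ends a₂ o) ∩
                (connEvent ends a₁ a₂)ᶜ)) -
        prob p ((connEvent ends a₁ o ∪ connEvent ends a₂ o) ∩ (connEvent ends a₁ a₂)ᶜ) *
          (prob p (connEvent ends a₁ a₂)ᶜ *
              prob p (connEvent ends a₁ b ∩ connEvent ends a₂ u ∩ (connEvent ends a₁ a₂)ᶜ) -
            prob p (connEvent ends a₁ b ∩ (connEvent ends a₁ a₂)ᶜ) *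
              prob p (connEvent ends a₂ u ∩ (connEvent ends a₁ a₂)ᶜ)) -
        prob p (connEvent ends a₁ a₂)ᶜ *
          (prob p (connEvent ends a₁ a₂)ᶜ *
              prob p (connEvent ends a₁ b ∩ connEvent ends a₂ o ∩ (connEvent ends a₁ a₂)ᶜ) -
            prob p (connEvent ends a₁ b ∩ (connEvent ends a₁ a₂)ᶜ) *
              prob p (connEvent ends a₂ o ∩ (connEvent ends a₁ a₂)ᶜ)) = 0 := by
  classical
  set D := (connEvent ends a₁ a₂)ᶜ with hDdef
  set Lb := connEvent ends a₁ b
  set Hu := connEvent ends a₂ u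
  set Lo := connEvent ends a₁ o
  set Ho := connEvent ends a₂ o
  -- side descriptions
  have sLb : ∀ ω ∈ D, ω ∈ Lb ↔ restrictTo (side₁ ends V₁)ᶜ ω ∈ Lb := fun _ hD => conn_side₂ hs hD (Or.inl rfl) hb
  have sHu : ∀ ω ∈ D, ω ∈ Hu ↔ restrictTo (side₁ ends V₁) ω ∈ Hu := fun _ hD => conn_side₁ hs hD (Or.inr rfl) hu
  have sLo : ∀ ω ∈ D, ω ∈ Lo ↔ restrictTo (side₁ ends V₁) ω ∈ Lo := fun _ hD => conn_side₁ hs hD (Or.inl rfl) ho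
  have sHo : ∀ ω ∈ D, ω ∈ Ho ↔ restrictTo (side₁ ends V₁) ω ∈ Ho := fun _ hD => conn_side₁ hs hD (Or.inr rfl) ho
  have soU := side_union sLo sHo
  -- the three product identities: `X` on side 1 (`u`, `o`), `Y = L_b` on side 2
  have I1 := prob_side_mul p hs (X := Hu ∩ (Lo ∪ Ho)) (Y := Lb) (side_inter sHu soU) sLb
  have I2 := prob_side_mul p hs (X := Hu) (Y := Lb) sHu sLb
  have I3 := prob_side_mul p hs (X := Ho) (Y := Lb) sHo sLb
  have e1 : Lb ∩ Hu ∩ (Lo ∪ Ho) ∩ D = Hu ∩ (Lo ∪ Ho) ∩ Lb ∩ D := by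
    ext ω; simp only [Set.mem_inter_iff, Set.mem_union]; tauto
  have e2 : Lb ∩ Hu ∩ D = Hu ∩ Lb ∩ D := by
    ext ω; simp only [Set.mem_inter_iff]; tauto
  have e3 : Lb ∩ Ho ∩ D = Ho ∩ Lb ∩ D := by
    ext ω; simp only [Set.mem_inter_iff]; tauto
  rw [e1, e2, e3]
  linear_combination (prob p D) * I1 - prob p ((Lo ∪ Ho) ∩ D) * I2 - prob p D * I3

omit [Fintype V] [DecidableEq V] in
/-- **Theorem 7 (ii).**  If `b` and `u` lie on one side and `o` on the other, the cleared L-half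
vanishes. -/
theorem halfL_eq_zero_of_o_alone (p : E → R) {ends : E → Sym2 V} {a₁ a₂ : V}
    {V₁ V₂ : Set V} (hs : IsRootPairSep ends a₁ a₂ V₁ V₂) {o u b : V}
    (ho : o ∈ V₁) (hu : u ∈ V₂) (hb : b ∈ V₂) :
    prob p (connEvent ends a₁ a₂)ᶜ *
          (prob p (connEvent ends a₁ a₂)ᶜ *
              prob p (connEvent ends a₁ b ∩ connEvent ends a₂ u ∩
                (connEvent ends a₁ o ∪ connEvent ends a₂ o) ∩ (connEvent ends a₁ a₂)ᶜ) -
            prob p (connEvent ends a₁ b ∩ (connEvent ends a₁ a₂)ᶜ) *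
              prob p (connEvent ends a₂ u ∩ (connEvent ends a₁ o ∪ connEvent ends a₂ o) ∩
                (connEvent ends a₁ a₂)ᶜ)) -
        prob p ((connEvent ends a₁ o ∪ connEvent ends a₂ o) ∩ (connEvent ends a₁ a₂)ᶜ) *
          (prob p (connEvent ends a₁ a₂)ᶜ *
              prob p (connEvent ends a₁ b ∩ connEvent ends a₂ u ∩ (connEvent ends a₁ a₂)ᶜ) -
            prob p (connEvent ends a₁ b ∩ (connEvent ends a₁ a₂)ᶜ) *
              prob p (connEvent ends a₂ u ∩ (connEvent ends a₁ a₂)ᶜ)) -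
        prob p (connEvent ends a₁ a₂)ᶜ *
          (prob p (connEvent ends a₁ a₂)ᶜ *
              prob p (connEvent ends a₁ b ∩ connEvent ends a₂ o ∩ (connEvent ends a₁ a₂)ᶜ) -
            prob p (connEvent ends a₁ b ∩ (connEvent ends a₁ a₂)ᶜ) *
              prob p (connEvent ends a₂ o ∩ (connEvent ends a₁ a₂)ᶜ)) = 0 := by
  classical
  set D := (connEvent ends a₁ a₂)ᶜ with hDdef
  set Lb := connEvent ends a₁ b
  set Hu := connEvent ends a₂ u
  set Lo := connEvent ends a₁ o
  set Ho := connEvent ends a₂ o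
  have sLb : ∀ ω ∈ D, ω ∈ Lb ↔ restrictTo (side₁ ends V₁)ᶜ ω ∈ Lb := fun _ hD => conn_side₂ hs hD (Or.inl rfl) hb
  have sHu : ∀ ω ∈ D, ω ∈ Hu ↔ restrictTo (side₁ ends V₁)ᶜ ω ∈ Hu := fun _ hD => conn_side₂ hs hD (Or.inr rfl) hu
  have sLo : ∀ ω ∈ D, ω ∈ Lo ↔ restrictTo (side₁ ends V₁) ω ∈ Lo := fun _ hD => conn_side₁ hs hD (Or.inl rfl) ho
  have sHo : ∀ ω ∈ D, ω ∈ Ho ↔ restrictTo (side₁ ends V₁) ω ∈ Ho := fun _ hD => conn_side₁ hs hD (Or.inr rfl) ho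
  have soU := side_union sLo sHo
  -- side 1 = o, side 2 = b and u: `prob_side_mul` takes `X` on side 1 and `Y` on side 2
  have J1 := prob_side_mul p hs (X := Lo ∪ Ho) (Y := Lb ∩ Hu) soU (side_inter sLb sHu)
  have J2 := prob_side_mul p hs (X := Lo ∪ Ho) (Y := Hu) soU sHu
  have J3 := prob_side_mul p hs (X := Ho) (Y := Lb) sHo sLb
  have e1 : Lb ∩ Hu ∩ (Lo ∪ Ho) ∩ D = (Lo ∪ Ho) ∩ (Lb ∩ Hu) ∩ D := by
    ext ω; simp only [Set.mem_inter_iff, Set.mem_union]; tauto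
  have e2 : Hu ∩ (Lo ∪ Ho) ∩ D = (Lo ∪ Ho) ∩ Hu ∩ D := by
    ext ω; simp only [Set.mem_inter_iff, Set.mem_union]; tauto
  have e3 : Lb ∩ Ho ∩ D = Ho ∩ Lb ∩ D := by
    ext ω; simp only [Set.mem_inter_iff]; tauto
  rw [e1, e2, e3]
  linear_combination (prob p D) * J1 - prob p (Lb ∩ D) * J2 - prob p D * J3

/-- **Theorem 7 (iii).**  If `b` and `o` lie on one side and `u` on the other, the cleared L-half
is `P(H_u Q)·[P(Q)P(L_b L_o Q) − P(L_b Q)P(L_o Q)] + (P(H_u Q) − P(Q))·[P(Q)P(L_b H_o Q) − P(L_b Q)P(H_o Q)] ≥ 0`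
(BHK 1.3 and BHK 1.4). -/
theorem halfL_nonneg_of_u_alone (p : E → R) (hp : IsProbVec p) {ends : E → Sym2 V}
    {a₁ a₂ : V} {V₁ V₂ : Set V} (hs : IsRootPairSep ends a₁ a₂ V₁ V₂) {o u b : V}
    (ho : o ∈ V₂) (hu : u ∈ V₁) (hb : b ∈ V₂) :
    0 ≤ prob p (connEvent ends a₁ a₂)ᶜ *
          (prob p (connEvent ends a₁ a₂)ᶜ *
              prob p (connEvent ends a₁ b ∩ connEvent ends a₂ u ∩
                (connEvent ends a₁ o ∪ connEvent ends a₂ o) ∩ (connEvent ends a₁ a₂)ᶜ) -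
            prob p (connEvent ends a₁ b ∩ (connEvent ends a₁ a₂)ᶜ) *
              prob p (connEvent ends a₂ u ∩ (connEvent ends a₁ o ∪ connEvent ends a₂ o) ∩
                (connEvent ends a₁ a₂)ᶜ)) -
        prob p ((connEvent ends a₁ o ∪ connEvent ends a₂ o) ∩ (connEvent ends a₁ a₂)ᶜ) *
          (prob p (connEvent ends a₁ a₂)ᶜ *
              prob p (connEvent ends a₁ b ∩ connEvent ends a₂ u ∩ (connEvent ends a₁ a₂)ᶜ) -
            prob p (connEvent ends a₁ b ∩ (connEvent ends a₁ a₂)ᶜ) *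
              prob p (connEvent ends a₂ u ∩ (connEvent ends a₁ a₂)ᶜ)) -
        prob p (connEvent ends a₁ a₂)ᶜ *
          (prob p (connEvent ends a₁ a₂)ᶜ *
              prob p (connEvent ends a₁ b ∩ connEvent ends a₂ o ∩ (connEvent ends a₁ a₂)ᶜ) -
            prob p (connEvent ends a₁ b ∩ (connEvent ends a₁ a₂)ᶜ) *
              prob p (connEvent ends a₂ o ∩ (connEvent ends a₁ a₂)ᶜ)) := by
  classical
  set D := (connEvent ends a₁ a₂)ᶜ with hDdef
  set Lb := connEvent ends a₁ b
  set Hu := connEvent ends a₂ u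
  set Lo := connEvent ends a₁ o
  set Ho := connEvent ends a₂ o
  have sLb : ∀ ω ∈ D, ω ∈ Lb ↔ restrictTo (side₁ ends V₁)ᶜ ω ∈ Lb := fun _ hD => conn_side₂ hs hD (Or.inl rfl) hb
  have sHu : ∀ ω ∈ D, ω ∈ Hu ↔ restrictTo (side₁ ends V₁) ω ∈ Hu := fun _ hD => conn_side₁ hs hD (Or.inr rfl) hu
  have sLo : ∀ ω ∈ D, ω ∈ Lo ↔ restrictTo (side₁ ends V₁)ᶜ ω ∈ Lo := fun _ hD => conn_side₂ hs hD (Or.inl rfl) ho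
  have sHo : ∀ ω ∈ D, ω ∈ Ho ↔ restrictTo (side₁ ends V₁)ᶜ ω ∈ Ho := fun _ hD => conn_side₂ hs hD (Or.inr rfl) ho
  have soU := side_union sLo sHo
  -- side 1 = u, side 2 = b and o
  have K1 := prob_side_mul p hs (X := Hu) (Y := Lb ∩ (Lo ∪ Ho)) sHu (side_inter sLb soU)
  have K2 := prob_side_mul p hs (X := Hu) (Y := Lo ∪ Ho) sHu soU
  have K3 := prob_side_mul p hs (X := Hu) (Y := Lb) sHu sLb
  have e1 : Lb ∩ Hu ∩ (Lo ∪ Ho) ∩ D = Hu ∩ (Lb ∩ (Lo ∪ Ho)) ∩ D := by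
    ext ω; simp only [Set.mem_inter_iff, Set.mem_union]; tauto
  have e3 : Lb ∩ Hu ∩ D = Hu ∩ Lb ∩ D := by
    ext ω; simp only [Set.mem_inter_iff]; tauto
  rw [e1, e3]
  -- the disjoint splits of `oU = Lo ⊔ Ho` on `D`
  have hdisj : ∀ X : Set (Config E), Disjoint (X ∩ Lo ∩ D) (X ∩ Ho ∩ D) := by
    intro X
    rw [Set.disjoint_left]
    rintro ω ⟨⟨_, hLo⟩, hD⟩ ⟨⟨_, hHo⟩, _⟩
    exact hD (conn_trans hLo (conn_symm hHo))
  have split : ∀ X : Set (Config E), prob p (X ∩ (Lo ∪ Ho) ∩ D) =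
      prob p (X ∩ Lo ∩ D) + prob p (X ∩ Ho ∩ D) := by
    intro X
    rw [← prob_union_of_disjoint p (hdisj X)]
    congr 1
    ext ω; simp only [Set.mem_inter_iff, Set.mem_union]; tauto
  have s1 := split Lb
  have s2 : prob p ((Lo ∪ Ho) ∩ D) = prob p (Lo ∩ D) + prob p (Ho ∩ D) := by
    have := split Set.univ
    simpa only [Set.univ_inter] using this
  -- BHK 1.3 (same cluster) and BHK 1.4 (cross cluster)
  have B1 := bhk_same_cluster_events p hp ends a₁ a₂ (𝓤 := {W : Set V | b ∈ W})
    (𝓥 := {W : Set V | o ∈ W}) (fun _ _ h hW => h hW) (fun _ _ h hW => h hW)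
  rw [RProduct.clusterInEvent_mem_eq, RProduct.clusterInEvent_mem_eq] at B1
  have B2 := bhk_cross_cluster p hp ends a₁ a₂ (𝓤 := {W : Set V | b ∈ W})
    (𝓥 := {W : Set V | o ∈ W}) (fun _ _ h hW => h hW) (fun _ _ h hW => h hW)
  rw [RProduct.clusterInEvent_mem_eq, RProduct.clusterInEvent_mem_eq] at B2
  have hT : 0 ≤ prob p (Hu ∩ D) := prob_nonneg hp _
  have hTa : prob p (Hu ∩ D) ≤ prob p D := prob_inter_le_right hp _ _
  -- the identity
  have key : prob p D * (prob p D * prob p (Hu ∩ (Lb ∩ (Lo ∪ Ho)) ∩ D) -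
        prob p (Lb ∩ D) * prob p (Hu ∩ (Lo ∪ Ho) ∩ D)) -
      prob p ((Lo ∪ Ho) ∩ D) * (prob p D * prob p (Hu ∩ Lb ∩ D) -
        prob p (Lb ∩ D) * prob p (Hu ∩ D)) -
      prob p D * (prob p D * prob p (Lb ∩ Ho ∩ D) - prob p (Lb ∩ D) * prob p (Ho ∩ D)) =
      prob p (Hu ∩ D) * (prob p D * prob p (Lb ∩ Lo ∩ D) - prob p (Lb ∩ D) * prob p (Lo ∩ D)) +
        (prob p (Hu ∩ D) - prob p D) *
          (prob p D * prob p (Lb ∩ Ho ∩ D) - prob p (Lb ∩ D) * prob p (Ho ∩ D)) := by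
    linear_combination (prob p D) * K1 - prob p (Lb ∩ D) * K2 - prob p ((Lo ∪ Ho) ∩ D) * K3 +
      prob p (Hu ∩ D) * prob p D * s1 - prob p (Hu ∩ D) * prob p (Lb ∩ D) * s2
  rw [key]
  have h1 : 0 ≤ prob p (Hu ∩ D) *
      (prob p D * prob p (Lb ∩ Lo ∩ D) - prob p (Lb ∩ D) * prob p (Lo ∩ D)) :=
    mul_nonneg hT (by linarith [B1])
  have h2 : 0 ≤ (prob p (Hu ∩ D) - prob p D) *
      (prob p D * prob p (Lb ∩ Ho ∩ D) - prob p (Lb ∩ D) * prob p (Ho ∩ D)) :=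
    mul_nonneg_of_nonpos_of_nonpos (by linarith) (by linarith [B2])
  linarith

end Main

end RootPairSep

end Summit.Ventures.PercRepro2
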